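import Summits.QuantumAdvantage.AdviceFreeQNC0.MassInequalityK
import HarnessLib

/-!
# Cell qa-qnc0 (rung F-Q1, density axis): DISJOINT DOMINATION CERTIFICATES — the generic, table-driven checker
# (Sketch13 v6e `DisjointDom`/`IsOpt1`; planner qa-qnc0-p1 ROUND-12 §2.10 (xi-q); instances in
# `DominationSmall.lean` (`m = 5, 6`) and `DominationSeven.lean` (`m = 7`))

A DISJOINT DOMINATION CERTIFICATE for a word `K0 : {0,1}^m → {0,1}` with zero set `Z` is a table giving every
`z ∈ Z` a list `R z ⊆ Zᶜ` such that `A(z) = ⊕_{u ∈ R z} A(u)` for every codeword `A ∈ C_m` (`IsElim1 m A`),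
the sets `{z} ∪ R z` pairwise disjoint.  This file makes the checker of `DominationSeven.lean` GENERIC in `m`
(namespace `DomCert`):

* three finite checks — `DomCert.ListsOK` (outside-ness, no duplicates, even length), `DomCert.SepOK`
  (pairwise separation), `DomCert.GensOK` (each relation kills the `2(m+1)` generators `(x^S,0)`, `(0,x^S)`,
  `#S ≤ 1`, of `lowDeg 1 × lowDeg 1` under the linear pattern map `(T₀,T₁) ↦ A`) — to be discharged per
  instance by `decide +kernel`;
* `DomCert.apply_iff_odd` — the relations then hold for EVERY codeword (linearity + `Submodule.span_induction`);
* `DomCert.failCount_le` / `DomCert.isOpt1_of` — OPTIMALITY of `K0` from the same certificate: the sets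
  `{z} ∪ R z` are pairwise disjoint odd dual words, so every codeword vanishes somewhere in each of them,
  `failCount K0 = #Z ≤ failCount X`;
* `DomCert.disjointDom_of` — `DisjointDom m K0`, and `DomCert.massIneqK_of` — with `domPays`
  (`MassInequalityK.lean`) the mass inequality `MassIneqK m k K0` at every level `k`.

WHAT THIS IS NOT: a certificate exists only for `m ≤ 7` (`6w ≤ 2^m − w` fails from `m = 8` on, planner
(xi-q)); `MassIneqKPays` is not proved here; MULT₁ at paying block sizes is OPEN; separation NOT moved.
-/

namespace Summit.QuantumAdvantage.AdviceFreeQNC0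

open Finset
open Literature.Computability.MetaComplexity Literature.Computability.MetaComplexity.Smolensky

namespace MassInequality

namespace DomCert

variable {m : ℕ}

/-! ### Certificate tables and the three finite checks -/

/-- The outside relation of an inside point `z`, read off a certificate table (empty if `z` has no row). -/
def Rl (tab : List ((Fin m → Bool) × List (Fin m → Bool))) (z : Fin m → Bool) : List (Fin m → Bool) :=
  ((tab.filter fun e => e.1 = z).map fun e => e.2).flatten

/-- The outside relation of `z` as a finset. -/
def R (tab : List ((Fin m → Bool) × List (Fin m → Bool))) (z : Fin m → Bool) : Finset (Fin m → Bool) :=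
  (Rl tab z).toFinset

/-- CHECK 1 (lists): the relation of every inside point lives outside `Z(K0)`, has no duplicates, and has EVEN
length. -/
def ListsOK (K0 : (Fin m → Bool) → Bool) (tab : List ((Fin m → Bool) × List (Fin m → Bool))) : Prop :=
  ∀ z, K0 z = false → (∀ u ∈ Rl tab z, K0 u = true) ∧ (Rl tab z).Nodup ∧ (Rl tab z).length % 2 = 0

/-- CHECK 2 (separation): the sets `{z} ∪ R z`, `z ∈ Z(K0)`, are pairwise disjoint. -/
def SepOK (K0 : (Fin m → Bool) → Bool) (tab : List ((Fin m → Bool) × List (Fin m → Bool))) : Prop :=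
  ∀ z z', K0 z = false → K0 z' = false → z ≠ z' → z ∉ Rl tab z' ∧ ∀ u ∈ Rl tab z, u ≠ z' ∧ u ∉ Rl tab z'

/-- The pattern of the pair `(p, q)` read by `|u| mod 3` (with `T₂ = T₀ + T₁`), in `𝔽₂`. -/
def patZ (p q : CubeFn (ZMod 2) m) (u : Fin m → Bool) : ZMod 2 :=
  if wt u % 3 = 0 then p u else if wt u % 3 = 1 then q u else p u + q u

/-- CHECK 3 (generators): every relation kills the generators `(x^S, 0)`, `(0, x^S)` (`#S ≤ 1`). -/
def GensOK (K0 : (Fin m → Bool) → Bool) (tab : List ((Fin m → Bool) × List (Fin m → Bool))) : Prop :=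
  ∀ z, K0 z = false → ∀ S ∈ (univ : Finset (Finset (Fin m))).filter (fun S => S.card ≤ 1),
    patZ (mono (ZMod 2) S) 0 z + ((Rl tab z).map (patZ (mono (ZMod 2) S) 0)).sum = 0 ∧
      patZ 0 (mono (ZMod 2) S) z + ((Rl tab z).map (patZ 0 (mono (ZMod 2) S))).sum = 0

/-- The relation of `z` evaluated on the pair `(p, q)`: `pat(z) + Σ_{u ∈ R z} pat(u)`. -/
def relZ (tab : List ((Fin m → Bool) × List (Fin m → Bool))) (z : Fin m → Bool) (p q : CubeFn (ZMod 2) m) :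
    ZMod 2 :=
  patZ p q z + ∑ u ∈ R tab z, patZ p q u

variable {K0 : (Fin m → Bool) → Bool} {tab : List ((Fin m → Bool) × List (Fin m → Bool))}

/-- Sums over `R z` are list sums. -/
theorem sum_R (hl : ListsOK K0 tab) {z : Fin m → Bool} (hz : K0 z = false) (f : (Fin m → Bool) → ZMod 2) :
    ∑ u ∈ R tab z, f u = ((Rl tab z).map f).sum := by
  unfold R
  exact List.sum_toFinset f (hl z hz).2.1

/-- `#(R z)` is the length of the list. -/
theorem card_R (hl : ListsOK K0 tab) {z : Fin m → Bool} (hz : K0 z = false) :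
    (R tab z).card = (Rl tab z).length := by
  unfold R
  exact List.toFinset_card_of_nodup (hl z hz).2.1

/-! ### Linearity of the relations -/

/-- `relZ` splits over the pair. -/
theorem relZ_split (z : Fin m → Bool) (p q : CubeFn (ZMod 2) m) :
    relZ tab z p q = relZ tab z p 0 + relZ tab z 0 q := by
  unfold relZ
  have h : ∀ u, patZ p q u = patZ p 0 u + patZ 0 q u := fun u => by
    unfold patZ; split_ifs <;> simp
  rw [h, Finset.sum_congr rfl fun u _ => h u, sum_add_distrib]; ring

/-- `relZ z · 0` is additive. -/
theorem relZ_add_left (z : Fin m → Bool) (p p' : CubeFn (ZMod 2) m) :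
    relZ tab z (p + p') 0 = relZ tab z p 0 + relZ tab z p' 0 := by
  unfold relZ
  have h : ∀ u, patZ (p + p') 0 u = patZ p 0 u + patZ p' 0 u := fun u => by
    unfold patZ; split_ifs <;> simp
  rw [h, Finset.sum_congr rfl fun u _ => h u, sum_add_distrib]; ring

/-- `relZ z 0 ·` is additive. -/
theorem relZ_add_right (z : Fin m → Bool) (q q' : CubeFn (ZMod 2) m) :
    relZ tab z 0 (q + q') = relZ tab z 0 q + relZ tab z 0 q' := by
  unfold relZ
  have h : ∀ u, patZ 0 (q + q') u = patZ 0 q u + patZ 0 q' u := fun u => by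
    unfold patZ; split_ifs <;> simp
  rw [h, Finset.sum_congr rfl fun u _ => h u, sum_add_distrib]; ring

/-- `relZ z (c • p) 0 = c * relZ z p 0`. -/
theorem relZ_smul_left (z : Fin m → Bool) (c : ZMod 2) (p : CubeFn (ZMod 2) m) :
    relZ tab z (c • p) 0 = c * relZ tab z p 0 := by
  unfold relZ
  have h : ∀ u, patZ (c • p) 0 u = c * patZ p 0 u := fun u => by
    unfold patZ; split_ifs <;> simp
  rw [h, Finset.sum_congr rfl fun u _ => h u, ← mul_sum]; ring

/-- `relZ z 0 (c • q) = c * relZ z 0 q`. -/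
theorem relZ_smul_right (z : Fin m → Bool) (c : ZMod 2) (q : CubeFn (ZMod 2) m) :
    relZ tab z 0 (c • q) = c * relZ tab z 0 q := by
  unfold relZ
  have h : ∀ u, patZ 0 (c • q) u = c * patZ 0 q u := fun u => by
    unfold patZ; split_ifs <;> simp
  rw [h, Finset.sum_congr rfl fun u _ => h u, ← mul_sum]; ring

/-- The generator check in `relZ` form. -/
theorem gens_check (hl : ListsOK K0 tab) (hg : GensOK K0 tab) {z : Fin m → Bool} (hz : K0 z = false)
    {S : Finset (Fin m)} (hS : S.card ≤ 1) :
    relZ tab z (mono (ZMod 2) S) 0 = 0 ∧ relZ tab z 0 (mono (ZMod 2) S) = 0 := by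
  unfold relZ
  rw [sum_R hl hz, sum_R hl hz]
  exact hg z hz S (mem_filter.2 ⟨mem_univ _, hS⟩)

/-- Every relation kills every degree-`≤ 1` function on the left … -/
theorem relZ_left_of_lowDeg (hl : ListsOK K0 tab) (hg : GensOK K0 tab) {z : Fin m → Bool} (hz : K0 z = false)
    {p : CubeFn (ZMod 2) m} (hp : p ∈ lowDeg (ZMod 2) m 1) : relZ tab z p 0 = 0 := by
  rw [lowDeg_eq_span] at hp
  induction hp using Submodule.span_induction with
  | mem x hx =>
    obtain ⟨⟨S, hS⟩, rfl⟩ := hx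
    exact (gens_check hl hg hz hS).1
  | zero => unfold relZ patZ; simp
  | add x y _ _ hx hy => rw [relZ_add_left, hx, hy, add_zero]
  | smul c x _ hx => rw [relZ_smul_left, hx, mul_zero]

/-- … and on the right. -/
theorem relZ_right_of_lowDeg (hl : ListsOK K0 tab) (hg : GensOK K0 tab) {z : Fin m → Bool} (hz : K0 z = false)
    {q : CubeFn (ZMod 2) m} (hq : q ∈ lowDeg (ZMod 2) m 1) : relZ tab z 0 q = 0 := by
  rw [lowDeg_eq_span] at hq
  induction hq using Submodule.span_induction with
  | mem x hx =>
    obtain ⟨⟨S, hS⟩, rfl⟩ := hx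
    exact (gens_check hl hg hz hS).2
  | zero => unfold relZ patZ; simp
  | add x y _ _ hx hy => rw [relZ_add_right, hx, hy, add_zero]
  | smul c x _ hx => rw [relZ_smul_right, hx, mul_zero]

/-! ### The relations hold for every codeword -/

/-- **The relations hold for every codeword**: `A(z) ↔ #(R z ∩ supp A)` odd. -/
theorem apply_iff_odd (hl : ListsOK K0 tab) (hg : GensOK K0 tab) {z : Fin m → Bool} (hz : K0 z = false)
    {A : (Fin m → Bool) → Bool} (hA : IsElim1 m A) :
    A z = true ↔ Odd ((R tab z).filter (fun u => A u = true)).card := by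
  obtain ⟨T, hT, hTe, hTA⟩ := hA
  set p : CubeFn (ZMod 2) m := fun u => if T 0 u = true then 1 else 0 with hp
  set q : CubeFn (ZMod 2) m := fun u => if T 1 u = true then 1 else 0 with hq
  have hpat : ∀ u, (if A u = true then (1 : ZMod 2) else 0) = patZ p q u := by
    intro u
    rw [hTA u]
    unfold patZ
    have h3 : wt u % 3 < 3 := Nat.mod_lt _ (by norm_num)
    have hev := hTe u
    generalize wt u % 3 = r at h3
    interval_cases r
    · simp [hp]
    · simp [hq]
    · simp only [hp, hq, show (2 : ℕ) = 0 ↔ False from by norm_num, show (2 : ℕ) = 1 ↔ False from by norm_num,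
        if_false]
      revert hev
      cases T 0 u <;> cases T 1 u <;> cases T 2 u <;> decide
  have hrel : relZ tab z p q = 0 := by
    rw [relZ_split, relZ_left_of_lowDeg hl hg hz (hT 0), relZ_right_of_lowDeg hl hg hz (hT 1), add_zero]
  unfold relZ at hrel
  rw [← hpat z, Finset.sum_congr rfl fun u _ => (hpat u).symm, ← Finset.sum_filter] at hrel
  simp only [sum_const, nsmul_eq_mul, mul_one] at hrel
  -- `[A z] + #filter = 0` in `𝔽₂`
  rw [← ZMod.natCast_eq_one_iff_odd]
  constructor
  · intro h
    rw [h, if_pos rfl] at hrel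
    have : (((filter (fun u => A u = true) (R tab z)).card : ℕ) : ZMod 2) = -1 := by
      linear_combination hrel
    rw [this]; decide
  · intro h
    rw [h] at hrel
    by_contra hne
    rw [if_neg hne] at hrel
    exact absurd hrel (by decide)

/-! ### Disjointness, outside-ness, optimality -/

/-- The relation sets live outside `Z`. -/
theorem outside (hl : ListsOK K0 tab) {z : Fin m → Bool} (hz : K0 z = false) : ∀ u ∈ R tab z, K0 u = true :=
  fun u hu => (hl z hz).1 u (List.mem_toFinset.1 hu)

/-- The sets `{z} ∪ R z` (`z ∈ Z`) are pairwise disjoint. -/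
theorem disjoint_sets (hs : SepOK K0 tab) {z z' : Fin m → Bool} (hz : K0 z = false) (hz' : K0 z' = false)
    (hne : z ≠ z') : Disjoint (insert z (R tab z)) (insert z' (R tab z')) := by
  obtain ⟨hzz', hsep⟩ := hs z z' hz hz' hne
  rw [Finset.disjoint_left]
  intro u hu hu'
  rw [mem_insert] at hu hu'
  unfold R at hu hu'
  rw [List.mem_toFinset] at hu hu'
  rcases hu with rfl | hu
  · rcases hu' with h | h
    · exact hne h
    · exact hzz' h
  · rcases hu' with rfl | h
    · exact (hsep _ hu).1 rfl
    · exact (hsep _ hu).2 h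

/-- Every codeword has a zero in each certificate set `{z} ∪ R z` (the sets are ODD dual words). -/
theorem exists_zero (hl : ListsOK K0 tab) (hg : GensOK K0 tab) {A : (Fin m → Bool) → Bool} (hA : IsElim1 m A)
    {z : Fin m → Bool} (hz : K0 z = false) : ∃ u ∈ insert z (R tab z), A u = false := by
  by_cases hAz : A z = true
  · have hodd := (apply_iff_odd hl hg hz hA).1 hAz
    by_contra hall
    push Not at hall
    have hfull : (R tab z).filter (fun u => A u = true) = R tab z := by
      refine filter_true_of_mem fun u hu => ?_
      have := hall u (mem_insert_of_mem hu)
      cases hAu : A u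
      · exact absurd hAu this
      · rfl
    rw [hfull, card_R hl hz] at hodd
    have h1 := Nat.odd_iff.1 hodd
    have h2 := (hl z hz).2.2
    omega
  · exact ⟨z, mem_insert_self _ _, by cases h : A z <;> simp_all⟩

/-- **Optimality from the certificate**: every codeword has at least `#Z(K0)` zeros. -/
theorem failCount_le (hl : ListsOK K0 tab) (hs : SepOK K0 tab) (hg : GensOK K0 tab)
    {X : (Fin m → Bool) → Bool} (hX : IsElim1 m X) : failCount K0 ≤ failCount X := by
  classical
  -- choose a zero of `X` in each certificate set
  have hch : ∀ z : Fin m → Bool, ∃ u : Fin m → Bool, K0 z = false → u ∈ insert z (R tab z) ∧ X u = false := by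
    intro z
    by_cases hz : K0 z = false
    · obtain ⟨u, hu, hXu⟩ := exists_zero hl hg hX hz
      exact ⟨u, fun _ => ⟨hu, hXu⟩⟩
    · exact ⟨z, fun h => absurd h hz⟩
  choose g hg' using hch
  unfold failCount
  refine card_le_card_of_injOn g (fun z hz => ?_) (fun z hz z' hz' h => ?_)
  · rw [mem_coe, mem_filter] at hz ⊢
    exact ⟨mem_univ _, (hg' z hz.2).2⟩
  · rw [mem_coe, mem_filter] at hz hz'
    by_contra hne
    have hd := disjoint_sets hs hz.2 hz'.2 hne
    exact disjoint_left.1 hd (hg' z hz.2).1 (h ▸ (hg' z' hz'.2).1)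

/-- Hence a CODEWORD with a certificate is optimal. -/
theorem isOpt1_of (hE : IsElim1 m K0) (hl : ListsOK K0 tab) (hs : SepOK K0 tab) (hg : GensOK K0 tab) :
    IsOpt1 m K0 :=
  ⟨hE, fun _ hX => failCount_le hl hs hg hX⟩

/-- And the certificate is a disjoint domination in the sense of `DisjointDom`. -/
theorem disjointDom_of (hl : ListsOK K0 tab) (hs : SepOK K0 tab) (hg : GensOK K0 tab) : DisjointDom m K0 :=
  ⟨R tab, fun _ hz => ⟨outside hl hz, fun _ hA => apply_iff_odd hl hg hz hA⟩,
    fun _ _ hz hz' hne =>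
      Disjoint.mono (subset_insert _ _) (subset_insert _ _) (disjoint_sets hs hz hz' hne)⟩

/-- The full package: certificate + codeword ⇒ optimal, dominated, and (by `domPays`) MI at every level. -/
theorem massIneqK_of (hl : ListsOK K0 tab) (hs : SepOK K0 tab) (hg : GensOK K0 tab) :
    ∀ k, 0 < k → MassIneqK m k K0 :=
  domPays m K0 (disjointDom_of hl hs hg)

end DomCert

end MassInequality

end Summit.QuantumAdvantage.AdviceFreeQNC0
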